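import Literature.Probability.RandomPlanarGeometry.YangBaxterSAWComplex
import Mathlib.Combinatorics.SimpleGraph.Paths

/-!
# `CompassEndpoints` (route SAWCompassLattice, item stmt-CriticalPhenomena-6968): face chains

Helper file (registered sub-goal `stub_compassEndpoints_faceChains`) of the stub
`stub_compassEndpoints` of the line `Sketch` for the crux
`Summit.CriticalPhenomena.SAWScalingLimit.Theses.SAWPhaseRetrieval.HexTransfer`
(stmt-CriticalPhenomena-14221). Pure combinatorics of the square grid of Glazman–Manolescu's
Yang–Baxter walks (`Literature.Probability.RandomPlanarGeometry.SAW.YangBaxter.YBWalk`): two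
faces are *adjacent* when they are distinct and share a side (a mid-edge);

* `exists_mids_of_faceChain` / **`exists_ybWalk_of_faceChain`**: a duplicate-free chain of
  adjacent faces `f₀, …, f_L` of a set of faces `S` carries a Yang–Baxter walk of `S` from a side
  of `f₀` to a side of `f_L` — the walk crossing the common sides `e_i` of `f_{i-1}, f_i` in order:
  the arc `(e_i, e_{i+1})` is drawn in the interior face `f_i`, these are pairwise distinct, so
  the crossed mid-edges are pairwise distinct, consecutive arcs lie in different faces and no face
  carries two arcs (in particular not the two crossing straight arcs); for `L = 0`, the trivial
  walk at the West side of `f₀`;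
* **`stub_compassEndpoints_faceChains`**: two faces joined in the adjacency graph of the faces of
  `S` are joined by a Yang–Baxter walk of `S` (shorten a joining walk to a path,
  `SimpleGraph.Walk.bypass`, and apply the above).
-/

open Literature.Probability.RandomPlanarGeometry.SAW.YangBaxter

namespace Summit.CriticalPhenomena.SAWScalingLimit.Cruxes.HexTransfer.Sketch

namespace Endpoints

/-- An arc joining two distinct sides of a face is drawn in that face. [folklore] -/
theorem arcFace_side_side (f : Face) {s t : Side} (hst : s ≠ t) :
    arcFace (f.side s, f.side t) = some f := by
  rw [arcFace, MidEdge.commonFace_eq_some_iff]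
  exact ⟨fun h => hst (Face.side_injective f h), ⟨s, rfl⟩, ⟨t, rfl⟩⟩

/-- A mid-edge that is a side of two distinct faces `f, g` borders no other face. [folklore] -/
theorem eq_or_eq_of_side_eq {f g x : Face} {e : MidEdge} (hfg : f ≠ g) (hf : ∃ s, f.side s = e)
    (hg : ∃ t, g.side t = e) (hx : ∃ s, x.side s = e) : x = f ∨ x = g := by
  rw [Face.exists_side_eq_iff] at hf hg hx
  rcases hf with hf | hf <;> rcases hg with hg | hg <;> rcases hx with hx | hx <;>
    first
    | exact Or.inl (hx.trans hf.symm)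
    | exact Or.inr (hx.trans hg.symm)
    | exact absurd (hf.trans hg.symm) hfg

/-- **The mid-edges crossed along a duplicate-free chain of adjacent faces** `f, g, l…` (at least
two faces): a list `a :: m` of mid-edges — `a` the common side of `f` and `g`, the last one a
side of the last face — which is duplicate-free, whose mid-edges border only faces of the chain,
whose arcs are drawn in the faces `g, l…`, consecutive ones in different faces, the first one in
`g`, and no two in the same face. (Induction on the chain: prepend the common side of the first
two faces.) [folklore] -/
theorem exists_mids_of_faceChain :
    ∀ (f g : Face) (l : List Face),
      (f :: g :: l).IsChain (fun f g => f ≠ g ∧ ∃ e : MidEdge, (∃ s, f.side s = e) ∧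
        ∃ t, g.side t = e) →
      (f :: g :: l).Nodup →
      ∃ (a : MidEdge) (m : List MidEdge), (∃ s, f.side s = a) ∧ (∃ s, g.side s = a) ∧
        (∃ b, (a :: m).getLast? = some b ∧
          ∃ s, ((g :: l).getLast (List.cons_ne_nil g l)).side s = b) ∧
        (a :: m).Nodup ∧
        (∀ e ∈ a :: m, ∀ x : Face, (∃ s, x.side s = e) → x ∈ f :: g :: l) ∧
        (∀ p ∈ arcsOf (a :: m), ∃ x ∈ g :: l, arcFace p = some x) ∧
        (arcsOf (a :: m)).IsChain (fun p q => arcFace p ≠ arcFace q) ∧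
        (∀ q ∈ m.head?, arcFace (a, q) = some g) ∧
        (∀ p ∈ arcsOf (a :: m), ∀ q ∈ arcsOf (a :: m), arcFace p = arcFace q → p = q)
  | f, g, [], hc, _ => by
    obtain ⟨hfg, e, hf, hg⟩ := List.isChain_pair.1 hc
    refine ⟨e, [], hf, hg, ⟨e, rfl, hg⟩, List.nodup_singleton e, ?_, by simp [arcsOf],
      by simp [arcsOf], by simp, by simp [arcsOf]⟩
    intro e' he' x hx
    rw [List.mem_singleton] at he'
    subst he'
    rcases eq_or_eq_of_side_eq hfg hf hg hx with rfl | rfl <;> simp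
  | f₀, f, g :: l, hc, hn => by
    obtain ⟨⟨hf₀f, e, hf₀, hf⟩, hc'⟩ := List.isChain_cons_cons.1 hc
    obtain ⟨a, m, hfa, -, hlast, hnd, hfaces, harcs, hchain, hfirst, hinj⟩ :=
      exists_mids_of_faceChain f g l hc' hn.of_cons
    have hf₀_notin : f₀ ∉ f :: g :: l := (List.nodup_cons.1 hn).1
    have hf_notin : f ∉ g :: l := (List.nodup_cons.1 hn.of_cons).1
    have he_notin : e ∉ a :: m := fun hmem => hf₀_notin (hfaces e hmem f₀ hf₀)
    have hea : e ≠ a := fun h => he_notin (h ▸ List.mem_cons_self)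
    -- the new arc `(e, a)` is drawn in `f`, the old ones in faces of `g :: l`
    have hnew : arcFace (e, a) = some f := by
      rw [arcFace, MidEdge.commonFace_eq_some_iff]
      exact ⟨hea, hf, hfa⟩
    have hold : ∀ r ∈ arcsOf (a :: m), arcFace r ≠ some f := fun r hr habs => by
      obtain ⟨x, hx, hrx⟩ := harcs r hr
      rw [habs, Option.some_inj] at hrx
      subst hrx
      exact hf_notin hx
    have harcs_eq : arcsOf (e :: a :: m) = (e, a) :: arcsOf (a :: m) := rfl
    refine ⟨e, a :: m, hf₀, hf, ?_, List.nodup_cons.2 ⟨he_notin, hnd⟩, ?_, ?_, ?_, ?_, ?_⟩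
    · obtain ⟨b, hb, hbs⟩ := hlast
      refine ⟨b, ?_, ?_⟩
      · rw [List.getLast?_cons_cons, hb]
      · rwa [List.getLast_cons_cons]
    · intro e' he' x hx
      rw [List.mem_cons] at he'
      rcases he' with rfl | he'
      · rcases eq_or_eq_of_side_eq hf₀f hf₀ hf hx with rfl | rfl <;> simp
      · exact List.mem_cons_of_mem _ (hfaces e' he' x hx)
    · intro p hp
      rw [harcs_eq, List.mem_cons] at hp
      rcases hp with rfl | hp
      · exact ⟨f, List.mem_cons_self, hnew⟩
      · obtain ⟨x, hx, hpx⟩ := harcs p hp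
        exact ⟨x, List.mem_cons_of_mem _ hx, hpx⟩
    · rw [harcs_eq]
      refine List.IsChain.cons hchain fun q hq => ?_
      have hqg : arcFace q = some g := by
        cases m with
        | nil => simp [arcsOf] at hq
        | cons a' m' =>
          simp only [arcsOf, List.tail_cons, List.zip_cons_cons, List.head?_cons,
            Option.mem_def, Option.some.injEq] at hq
          subst hq
          exact hfirst a' rfl
      rw [hnew, hqg, Ne, Option.some_inj]
      rintro rfl
      exact hf_notin List.mem_cons_self
    · intro q hq
      simp only [List.head?_cons, Option.mem_def, Option.some.injEq] at hq
      subst hq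
      exact hnew
    · intro p hp q hq hpq
      rw [harcs_eq, List.mem_cons] at hp hq
      rcases hp with rfl | hp <;> rcases hq with rfl | hq
      · rfl
      · exact absurd (hpq.symm.trans hnew) (hold q hq)
      · exact absurd (hpq.trans hnew) (hold p hp)
      · exact hinj p hp q hq hpq

/-- **A duplicate-free chain of adjacent faces of `S` carries a Yang–Baxter walk of `S`** from a
side of its first face to a side of its last face (each interior face of the chain carries
exactly one arc, so the walk is trivially non-crossing; for a single face, the trivial walk at its
West side). [folklore] -/
theorem exists_ybWalk_of_faceChain (S : Set Face) :
    ∀ (F : List Face) (hF : F ≠ []),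
      F.IsChain (fun f g => f ≠ g ∧ ∃ e : MidEdge, (∃ s, f.side s = e) ∧ ∃ t, g.side t = e) →
      F.Nodup → (∀ x ∈ F, x ∈ S) →
      ∃ a b : MidEdge, (∃ s, (F.head hF).side s = a) ∧ (∃ s, (F.getLast hF).side s = b) ∧
        Nonempty (YBWalk S a b)
  | [], hF, _, _, _ => absurd rfl hF
  | [f], _, _, _, _ => ⟨f.side .W, f.side .W, ⟨.W, rfl⟩, ⟨.W, rfl⟩, ⟨YBWalk.trivial _⟩⟩
  | f :: g :: l, _, hc, hn, hS => by
    obtain ⟨a, m, hfa, -, ⟨b, hb, hbs⟩, hnd, -, harcs, hchain, -, hinj⟩ :=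
      exists_mids_of_faceChain f g l hc hn
    refine ⟨a, b, hfa, by rwa [List.getLast_cons_cons], ⟨?_⟩⟩
    exact
      { mids := a :: m
        head_eq := rfl
        getLast_eq := hb
        nodup := hnd
        arc_mem := fun p hp => by
          obtain ⟨x, hx, hpx⟩ := harcs p hp
          exact ⟨x, hS x (List.mem_cons_of_mem _ hx), hpx⟩
        isChain := hchain
        noncross := fun x h₁ h₂ => by
          have key : ∀ p q, p ∈ arcsOf (a :: m) → q ∈ arcsOf (a :: m) →
              arcFace p = some x → arcFace q = some x → p = q :=
            fun p q hp hq hpx hqx => hinj p hp q hq (hpx.trans hqx.symm)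
          rcases h₁ with h₁ | h₁ <;> rcases h₂ with h₂ | h₂ <;>
            have := key _ _ h₁ h₂ (arcFace_side_side x (by decide))
              (arcFace_side_side x (by decide)) <;>
            simp [Face.side] at this }

/-- A walk of the adjacency graph of the faces of `S` that starts in `S` stays in `S`.
[folklore] -/
theorem forall_mem_support_mem {S : Set Face} {u v : Face}
    (p : (SimpleGraph.fromRel fun f g : Face =>
      (∃ e : MidEdge, (∃ s, f.side s = e) ∧ ∃ t, g.side t = e) ∧ f ∈ S ∧ g ∈ S).Walk u v)
    (hu : u ∈ S) : ∀ x ∈ p.support, x ∈ S := by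
  induction p with
  | nil => simpa using hu
  | cons h _ ih =>
    intro x hx
    rw [SimpleGraph.Walk.support_cons, List.mem_cons] at hx
    rcases hx with rfl | hx
    · exact hu
    · refine ih ?_ x hx
      rcases (SimpleGraph.fromRel_adj _ _ _).1 h with ⟨-, h | h⟩
      exacts [h.2.2, h.2.1]

end Endpoints

open Endpoints in
/-- **Faces joined inside a set of faces are joined by a Yang–Baxter walk** (registered sub-goal
of the stub `stub_compassEndpoints`, line `Sketch`, crux `HexTransfer`): if two faces `u, v` are
joined in the adjacency graph of the faces of `S` (adjacent = sharing a side, both in `S`) and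
`u ∈ S`, then some side of `u` and some side of `v` are joined by a Yang–Baxter walk of `S`
(`YBWalk S a b`). Shorten a joining walk to a path (`SimpleGraph.Walk.bypass`) and walk through
its faces (`exists_ybWalk_of_faceChain`). [folklore] -/
theorem stub_compassEndpoints_faceChains :
    ∀ (S : Set Face) (u v : Face), (SimpleGraph.fromRel fun f g : Face =>
      (∃ e : MidEdge, (∃ s, f.side s = e) ∧ ∃ t, g.side t = e) ∧ f ∈ S ∧ g ∈ S).Reachable u v →
      u ∈ S → ∃ a b : MidEdge, (∃ s, u.side s = a) ∧ (∃ s, v.side s = b) ∧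
        Nonempty (YBWalk S a b) := by
  classical
  intro S u v h hu
  obtain ⟨p⟩ := h
  have hchain : p.bypass.support.IsChain (fun f g => f ≠ g ∧ ∃ e : MidEdge,
      (∃ s, f.side s = e) ∧ ∃ t, g.side t = e) := by
    refine p.bypass.isChain_adj_support.imp fun f g hfg => ?_
    obtain ⟨hne, h | h⟩ := (SimpleGraph.fromRel_adj _ _ _).1 hfg
    · exact ⟨hne, h.1⟩
    · obtain ⟨e, hg, hf⟩ := h.1
      exact ⟨hne, e, hf, hg⟩
  obtain ⟨a, b, ha, hb, hw⟩ := exists_ybWalk_of_faceChain S p.bypass.support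
    p.bypass.support_ne_nil hchain p.bypass_isPath.support_nodup
    (forall_mem_support_mem p.bypass hu)
  rw [SimpleGraph.Walk.head_support] at ha
  rw [SimpleGraph.Walk.getLast_support] at hb
  exact ⟨a, b, ha, hb, hw⟩

end Summit.CriticalPhenomena.SAWScalingLimit.Cruxes.HexTransfer.Sketch
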